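import Literature.Combinatorics.Additive.TripleProductProperty
import Summits.MatrixMultiplication.MatrixMultiplication.Theorems.SnSubsetDichotomyThresholdSubsetTriplesPairFactorisation

/-!
# `SnSubsetDichotomy.ThresholdSubsetTriples`, line `interleaved-subsignature-ascent` — an exact owner pair admits no third class

Stub `stub_ownerPairNoThird` of crux `stmt-MatrixMultiplication-10882` (census c3a, negative design rule): for every
level set `L`, if the two owner chain classes `S_A = subsig (ownerSystem L)` and `S_B = subsig (ownerSystem Lᶜ)` form a
triple `(S_A, S_B, U)` with the triple product property (Cohn–Umans 2003, Def. 2.1, the tree's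
`Literature.Combinatorics.Additive.TripleProductProperty`), then `|U| ≤ 1`.

Proof = an explicit violating certificate.  By the landed exact pair factorisation `stub_pairFactorisation`
(`Theorems/SnSubsetDichotomyThresholdSubsetTriplesPairFactorisation.lean`), for `u, u' ∈ U` the quotient `u' u⁻¹`
is `a⁻¹ b` with `a ∈ S_A`, `b ∈ S_B`; both owner classes contain the identity word (every level of an owner system
carries its identity letter `swap k k = 1`), so the TPP sextuple `(s, s', t, t', u, u') = (1, a, b, 1, u, u')` has
product `a⁻¹ b · u u'⁻¹ = 1`, and the triple product property forces `u = u'`.  Elementary; Mathlib + the two landed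
files of the line.
-/

-- `Summit.<Summit>.<Problem>` is the tree's mandated summit-side namespace; for this single-conjunct summit the
-- two components coincide, so the file silences `dupNamespace` (same as the vocabulary file it imports).
set_option linter.dupNamespace false
set_option autoImplicit false

namespace Summit.MatrixMultiplication.MatrixMultiplication.Theorems.ThresholdSubsetTriples

open scoped Pointwise
open Literature.Combinatorics.Additive

/-- **No third class for an exact owner pair (stub `stub_ownerPairNoThird`, census c3a).**  If the owner chain
classes `subsig (ownerSystem L)`, `subsig (ownerSystem Lᶜ)` and a set `U` of permutations have the triple product
property, then `U` has at most one element: the pair already factorises `S_n` exactly (`stub_pairFactorisation`) and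
both classes contain `1`, so any two `u, u' ∈ U` complete to a TPP relation `1 · a⁻¹ · (b · 1⁻¹) · (u u'⁻¹) = 1`. -/
theorem stub_ownerPairNoThird {n : ℕ} (L : Finset (Fin n)) (U : Finset (Equiv.Perm (Fin n))) (hT : TripleProductProperty (subsig (ownerSystem L)) (subsig (ownerSystem Lᶜ)) U) : U.card ≤ 1 := by
  -- every level of a system carrying its identity letter contributes `swap k k = 1`, so `1` is a word of the class
  have one_mem : ∀ D : Fin n → Finset (Fin n), (∀ k, k ∈ D k) →
      ∀ m : ℕ, (1 : Equiv.Perm (Fin n)) ∈ subsigBelow D m := by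
    intro D hD m
    induction m with
    | zero =>
      rw [subsigBelow_zero]
      exact Finset.mem_singleton_self 1
    | succ m ih =>
      rw [subsigBelow_succ]
      refine Finset.mem_mul.2 ⟨1, ?_, 1, ih, one_mul 1⟩
      by_cases h : m < n
      · rw [dif_pos h]
        exact mem_starPiece.2 ⟨⟨m, h⟩, hD _, Equiv.swap_self _⟩
      · rw [dif_neg h]
        exact Finset.mem_singleton_self 1
  -- owner systems carry the identity letter at every level
  have owner_id : ∀ (L' : Finset (Fin n)) (k : Fin n), k ∈ ownerSystem L' k := by
    intro L' k
    by_cases hk : k ∈ L'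
    · rw [ownerSystem_of_mem hk, Finset.mem_filter]
      exact ⟨Finset.mem_univ _, le_rfl⟩
    · rw [ownerSystem_of_not_mem hk]
      exact Finset.mem_singleton_self k
  have h1A : (1 : Equiv.Perm (Fin n)) ∈ subsig (ownerSystem L) := one_mem _ (owner_id L) n
  have h1B : (1 : Equiv.Perm (Fin n)) ∈ subsig (ownerSystem Lᶜ) := one_mem _ (owner_id Lᶜ) n
  rw [Finset.card_le_one]
  intro u hu u' hu'
  -- the certificate: factor `u' u⁻¹ = a⁻¹ b` through the exact owner pair
  obtain ⟨p, ⟨ha, hb, hab⟩, -⟩ := stub_pairFactorisation L (u' * u⁻¹)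
  have key : (1 : Equiv.Perm (Fin n)) * p.1⁻¹ * (p.2 * 1⁻¹) * (u * u'⁻¹) = 1 := by
    rw [one_mul, inv_one, mul_one, hab, mul_assoc, inv_mul_cancel_left, mul_inv_cancel]
  exact (hT 1 h1A p.1 ha p.2 hb 1 h1B u hu u' hu' key).2.2

end Summit.MatrixMultiplication.MatrixMultiplication.Theorems.ThresholdSubsetTriples
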